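import Literature.NumberTheory.Transcendental.ExpOneTranscendenceMeasure
import Literature.NumberTheory.Transcendental.ExpOneTranscendenceMeasureMatrix
import Literature.NumberTheory.Transcendental.ExpOneTranscendenceMeasureDeterminant
import Literature.NumberTheory.Transcendental.ExpOneTranscendenceMeasureLiouville
import Literature.NumberTheory.Transcendental.ExpOneTranscendenceMeasureParams
import Literature.NumberTheory.Transcendental.ExpOneTranscendenceMeasureTransference
import HarnessLib

/-!
# Transcendence measure for `e` (Nesterenko–Waldschmidt 1996) — VII: the approximation measure and Theorem 4 (2)

Topic `Literature/NumberTheory/Transcendental`; sibling proof file of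
`ExpOneTranscendenceMeasure.lean` (the named fact
`Literature.NumberTheory.Transcendental.NesterenkoWaldschmidt1996_thm_4_2`). Everything here is
PROVED; no definitions, no named facts.

This part assembles parts I–VI into the proof of [NesterenkoWaldschmidt1996, Theorem 4 (1)] (the
Main Theorem 1 for `θ = β = 1`, `α = ξ`, §6 steps a)–d)), in the Mahler-measure form

* `NW1996.approx_measure_exp_one`: if `ξ` is a root of `Q ∈ ℤ[X]` irreducible over `ℚ`, `D = deg Q`,
  `ℓ ≥ max(1, log M(Q))`, then `|e - ξ| ≥ exp(-63021 · D² · (D + ℓ))`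

(the printed constant is `76000` with `ℓ = log L(ξ)`; our constant differs because the parameters
are re-tuned for the monomial basis `z^τ e^{tz}`, see part V), and then Theorem 4 (2) itself in the
unfolded form `NW1996.transcendence_measure_exp_one`:
`|P(e)| ≥ exp(-1.3·10⁵ d² (log L + d))` for `P ≠ 0`, `deg P ≤ d`, `L(P) ≤ L`, `L ≥ 3`, via the
transference of part II (constant `63021 + 3 ≤ 130000`); finally
`NesterenkoWaldschmidt1996_thm_4_2_holds` discharges the named fact
`Literature.NumberTheory.Transcendental.NesterenkoWaldschmidt1996_thm_4_2` (it is literally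
`transcendence_measure_exp_one`, with `(Real.exp 1 : ℂ) = cexp 1`).

Proof of `approx_measure_exp_one` (pp. 4–6 of the arXiv version, `H = 1`): assume
`|e - ξ| < exp(-63021 D²(D+ℓ)) ≤ E^{-L}`. a) The matrix `a(σ,s;τ,t) = pcoef(σ,τ,s,t) ξ^{ts}` has full
column rank (part VI, from the multiplicity estimate of part III), so some `L × L` minor `𝒟` is
non-zero. b) `𝒟 = det(f_{τ,t}^{(σ_μ)}(s_μ) + p_{μ,(τ,t)})` with `|p| ≤ E^{-L} 𝔐`,
`𝔐 = (ES₁)^T (T+T₁)^S e^{ET₁S₁}`, so part IV gives `|𝒟| ≤ 2^L L! 𝔐^L E^{LS} / E^{L(L-1)/2}`.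
c) `ξ^m 𝒟 = G(ξ)` for an integer polynomial `G` of degree `≤ 2m`, `m = S₁(T+1)T₁(T₁+1)`, and length
`≤ L! (S₁^T (T+T₁)^S)^L`, so Liouville (part I) gives `|𝒟| ≥ (L^L 𝔓^L)^{1-D} M(Q)^{-2m} 4^{-m}`.
d) The two bounds contradict the main inequality of part V.

## References

* [NesterenkoWaldschmidt1996] Yu. V. Nesterenko, M. Waldschmidt, *On the approximation of the values
  of exponential function and logarithm by algebraic numbers*, Mat. Zapiski 2 (1996), 23–42;
  arXiv:math/0002047, Theorem 4 and §6.
-/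

noncomputable section

open Polynomial Finset Complex Matrix

namespace Literature.NumberTheory.Transcendental

namespace NW1996

/-! ### Small analytic facts -/

/-- `N · 4^N ≤ e^{2.7 N}`. [folklore] -/
theorem nat_mul_four_pow_le_exp (N : ℕ) : (N : ℝ) * 4 ^ N ≤ Real.exp (2.7 * N) := by
  have h1 : (N : ℝ) ≤ Real.exp N := by have := Real.add_one_le_exp (N : ℝ); linarith
  have hlog4 : Real.log 4 ≤ 1.4 := by
    have h : Real.log 4 = 2 * Real.log 2 := by
      rw [show (4 : ℝ) = 2 ^ 2 by norm_num, Real.log_pow]; push_cast; ring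
    have := Real.log_two_lt_d9
    linarith
  have h2 : (4 : ℝ) ^ N ≤ Real.exp (1.4 * N) := by
    have h4 : (4 : ℝ) ^ N = Real.exp (N * Real.log 4) := by
      rw [Real.exp_nat_mul, Real.exp_log (by norm_num)]
    rw [h4, Real.exp_le_exp]
    nlinarith [Nat.cast_nonneg (α := ℝ) N]
  calc (N : ℝ) * 4 ^ N ≤ Real.exp N * Real.exp (1.4 * N) :=
        mul_le_mul h1 h2 (by positivity) (by positivity)
    _ = Real.exp (2.4 * N) := by rw [← Real.exp_add]; ring_nf
    _ ≤ Real.exp (2.7 * N) := Real.exp_le_exp.mpr (by nlinarith [Nat.cast_nonneg (α := ℝ) N])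

/-! ### Theorem 4 (1): the approximation measure -/

/-- **Nesterenko–Waldschmidt 1996, Theorem 4 (1)** (Mahler-measure form, re-tuned constant). Let
`Q ∈ ℤ[X]` be irreducible over `ℚ` of degree `D`, `ξ ∈ ℂ` a root of `Q`, and `ℓ ≥ 1` with
`log M(Q) ≤ ℓ` (e.g. `ℓ = log L(ξ)`, `L(ξ) ≥ 3`). Then `|e - ξ| ≥ exp(-63021 · D² · (D + ℓ))`.
[cite: NesterenkoWaldschmidt1996, Theorem 4 (1) and §6] -/
theorem approx_measure_exp_one {Q : ℤ[X]} (hQ : Irreducible (Q.map (Int.castRingHom ℚ))) {ξ : ℂ}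
    (hξQ : aeval ξ Q = 0) {ℓ : ℝ} (hℓ : 1 ≤ ℓ)
    (hMℓ : Real.log (Q.map (Int.castRingHom ℂ)).mahlerMeasure ≤ ℓ) :
    Real.exp (-(63021 * (Q.natDegree : ℝ) ^ 2 * (Q.natDegree + ℓ))) ≤ ‖cexp 1 - ξ‖ := by
  classical
  by_contra hlt
  push Not at hlt
  /- the parameters -/
  set D : ℕ := Q.natDegree with hD
  have hD1 : 1 ≤ D := natDegree_pos_of_irreducible_map hQ
  have hDr : (1 : ℝ) ≤ D := by exact_mod_cast hD1
  set Xr : ℝ := D + ℓ with hXr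
  set E : ℝ := Real.exp 1 * Xr with hE
  set lgE : ℝ := Real.log E with hlgE
  set V : ℝ := Xr / lgE with hV
  set T₁ : ℕ := 10 * D with hT₁
  set S₁ : ℕ := 40 * D with hS₁
  set T : ℕ := ⌊3000 * (D : ℝ) * V⌋₊ with hT
  set S : ℕ := ⌊1200 * (D : ℝ) * V⌋₊ with hS
  set L : ℕ := (T + 1) * (2 * T₁ + 1) with hL
  set m : ℕ := S₁ * (T + 1) * (T₁ * (T₁ + 1)) with hm
  obtain ⟨hEe, hlgE_eq, hlgE169, hlgEX, hV1, hVleX, hVX⟩ :=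
    params_basic D hD1 ℓ hℓ hXr hE hlgE hV
  have hlgEpos : 0 < lgE := by linarith only [hlgE169]
  obtain ⟨h2T₁, hcount, hLlo, hLhi, hΦ⟩ :=
    params_counts D hD1 hV1 hlgEpos hVX hT₁ hS₁ hT hS hL
  have hTle : (T : ℝ) ≤ 3000 * D * V := by rw [hT]; exact Nat.floor_le (by positivity)
  have hSle : (S : ℝ) ≤ 1200 * D * V := by rw [hS]; exact Nat.floor_le (by positivity)
  have hmain := params_main D hD1 ℓ hℓ hXr hE hlgE_eq hVX hV1 hVleX hT₁ hS₁ hTle hSle hLlo hLhi hL hm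
  obtain ⟨he27, he272⟩ := e_bounds
  have hX2 : 2 ≤ Xr := by rw [hXr]; linarith only [hDr, hℓ]
  have hEpos : 0 < E := by rw [hE]; positivity
  have hE1 : 1 ≤ E := le_trans (by linarith only [he27]) hEe
  have hE27 : (2.7 : ℝ) ≤ E := le_trans he27.le hEe
  have hexpE : Real.exp lgE = E := by rw [hlgE, Real.exp_log hEpos]
  have hT₁1 : 1 ≤ T₁ := by rw [hT₁]; omega
  have hS₁1 : 1 ≤ S₁ := by rw [hS₁]; omega
  have hS₁r : (1 : ℝ) ≤ S₁ := by exact_mod_cast hS₁1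
  have hLpos : (0 : ℝ) < L := lt_of_le_of_lt (by positivity) hLlo
  have hL1 : 1 ≤ L := by
    have : (0 : ℝ) < L := hLpos
    exact_mod_cast Nat.one_le_iff_ne_zero.mpr (by rintro h; rw [h] at this; simp at this)
  have hL1r : (1 : ℝ) ≤ L := by exact_mod_cast hL1
  /- the approximation `ξ` of `e` -/
  set e : ℂ := cexp 1 with he_def
  have he_norm : ‖e‖ = Real.exp 1 := by rw [he_def, Complex.norm_exp]; simp
  set δ : ℝ := ‖ξ - e‖ with hδ
  have hδlt : δ < Real.exp (-(63021 * (D : ℝ) ^ 2 * Xr)) := by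
    rw [hδ, norm_sub_rev]; simpa [hXr] using hlt
  set ε : ℝ := (E ^ L)⁻¹ with hε
  have hεpos : 0 < ε := by rw [hε]; positivity
  have hδε : δ ≤ ε := by
    refine hδlt.le.trans ?_
    rw [hε, ← hexpE, ← Real.exp_nat_mul, ← Real.exp_neg, Real.exp_le_exp]
    have : (L : ℝ) * lgE ≤ 63021 * (D : ℝ) ^ 2 * Xr := hΦ
    linarith only [this]
  have hεle1 : ε ≤ 1 := by
    rw [hε]; exact inv_le_one_of_one_le₀ (one_le_pow₀ hE1)
  have hδ1 : δ ≤ 1 := hδε.trans hεle1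
  have hξ1 : 1 ≤ ‖ξ‖ := by
    have h1 : ‖e‖ - ‖ξ - e‖ ≤ ‖ξ‖ := by
      have h2 := norm_sub_norm_le e ξ; rw [norm_sub_rev] at h2; linarith only [h2]
    rw [he_norm] at h1
    have h3 : ‖ξ - e‖ = δ := rfl
    rw [h3] at h1
    linarith only [h1, hδ1, he27]
  have hξ4 : ‖ξ‖ ≤ 4 := by
    have h1 : ‖ξ‖ ≤ ‖ξ - e‖ + ‖e‖ := norm_le_norm_sub_add ξ e
    rw [he_norm] at h1
    have h3 : ‖ξ - e‖ = δ := rfl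
    rw [h3] at h1
    linarith only [h1, hδ1, he272]
  have hξ0 : ξ ≠ 0 := fun h => by rw [h, norm_zero] at hξ1; exact absurd hξ1 (by norm_num)
  /- a) the matrix and a non-singular minor -/
  set A : Matrix (Fin (S + 1) × Fin (2 * S₁ + 1)) (Fin (T + 1) × Fin (2 * T₁ + 1)) ℂ :=
    Matrix.of fun ω μ => (pcoef ω.1 μ.1 ((ω.2 : ℤ) - S₁) ((μ.2 : ℤ) - T₁) : ℂ) *
      ξ ^ (((μ.2 : ℤ) - T₁) * ((ω.2 : ℤ) - S₁)) with hA
  have hcols : ∀ c, A *ᵥ c = 0 → c = 0 :=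
    fun c hc => algMatrix_mulVec_eq_zero hξ0 h2T₁.le hcount c hc
  obtain ⟨r, hr⟩ := exists_submatrix_det_ne_zero A hcols
  -- abbreviations for the chosen rows
  set σr : Fin (T + 1) × Fin (2 * T₁ + 1) → ℕ := fun i => ((r i).1 : ℕ) with hσr
  set sr : Fin (T + 1) × Fin (2 * T₁ + 1) → ℤ := fun i => ((r i).2 : ℤ) - S₁ with hsr
  set tc : Fin (T + 1) × Fin (2 * T₁ + 1) → ℤ := fun j => ((j.2 : ℤ) - T₁) with htc
  have hσrS : ∀ i, σr i ≤ S := fun i => Nat.lt_succ_iff.mp (r i).1.isLt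
  have hsrS : ∀ i, |sr i| ≤ S₁ := fun i => abs_coord_le S₁ (r i).2
  have htcT : ∀ j, |tc j| ≤ T₁ := fun j => abs_coord_le T₁ j.2
  have hτT : ∀ j : Fin (T + 1) × Fin (2 * T₁ + 1), (j.1 : ℕ) ≤ T := fun j => Nat.lt_succ_iff.mp j.1.isLt
  set Asq : Matrix (Fin (T + 1) × Fin (2 * T₁ + 1)) (Fin (T + 1) × Fin (2 * T₁ + 1)) ℂ :=
    A.submatrix r id with hAsq
  have hAsq_apply : ∀ i j, Asq i j = (pcoef (σr i) j.1 (sr i) (tc j) : ℂ) * ξ ^ (tc j * sr i) := by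
    intro i j; simp [hAsq, hA, hσr, hsr, htc]
  have hdet : Asq.det ≠ 0 := hr
  have hcard : Fintype.card (Fin (T + 1) × Fin (2 * T₁ + 1)) = L := by
    simp [Fintype.card_prod, Fintype.card_fin, hL]
  /- b) the analytic upper bound -/
  set f : Fin (T + 1) × Fin (2 * T₁ + 1) → ℂ → ℂ :=
    fun j z => z ^ (j.1 : ℕ) * cexp ((tc j : ℂ) * z) with hf
  have hf_diff : ∀ j, Differentiable ℂ (f j) := fun j => differentiable_monomialExp _ _
  set ζ : Fin (T + 1) × Fin (2 * T₁ + 1) → ℂ := fun i => ((sr i : ℤ) : ℂ) with hζ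
  set P : Fin (T + 1) × Fin (2 * T₁ + 1) → Fin (T + 1) × Fin (2 * T₁ + 1) → ℂ :=
    fun i j => Asq i j - iteratedDeriv (σr i) (f j) (ζ i) with hP
  set 𝔓 : ℝ := (S₁ : ℝ) ^ T * ((T : ℝ) + T₁) ^ S with h𝔓
  set 𝔐 : ℝ := (E * S₁) ^ T * ((T : ℝ) + T₁) ^ S * Real.exp (T₁ * (E * S₁)) with h𝔐
  have h𝔓pos : 0 < 𝔓 := by rw [h𝔓]; positivity
  have h𝔐pos : 0 < 𝔐 := by rw [h𝔐]; positivity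
  have hES₁ : 1 ≤ E * S₁ := one_le_mul_of_one_le_of_one_le hE1 hS₁r
  have hζS₁ : ∀ i, ‖ζ i‖ ≤ S₁ := by
    intro i
    simp only [hζ, Complex.norm_intCast]
    have := hsrS i
    rw [← Int.cast_abs]; exact_mod_cast this
  have hfM : ∀ i j z, ‖z‖ ≤ E * (S₁ : ℝ) → ‖iteratedDeriv (σr i) (f j) z‖ ≤ 𝔐 := by
    intro i j z hz
    exact norm_iteratedDeriv_monomialExp_le (hσrS i) (hτT j) hT₁1 (htcT j) hES₁ hz
  -- the perturbation
  have hγ : ∀ i j, iteratedDeriv (σr i) (f j) (ζ i) =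
      (pcoef (σr i) j.1 (sr i) (tc j) : ℂ) * e ^ (tc j * sr i) := by
    intro i j; exact iteratedDeriv_monomialExp_int (σr i) j.1 (sr i) (tc j)
  set N : ℕ := T₁ * S₁ with hN
  have htsN : ∀ i j, |tc j * sr i| ≤ N := by
    intro i j
    rw [abs_mul, hN]; push_cast
    exact mul_le_mul (htcT j) (hsrS i) (abs_nonneg _) (by positivity)
  have hPM : ∀ i j, ‖P i j‖ ≤ ε * 𝔐 := by
    intro i j
    have hPij : P i j = (pcoef (σr i) j.1 (sr i) (tc j) : ℂ) * (ξ ^ (tc j * sr i) - e ^ (tc j * sr i)) := by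
      simp only [hP]; rw [hAsq_apply, hγ]; ring
    rw [hPij, norm_mul]
    have h1 : ‖(pcoef (σr i) j.1 (sr i) (tc j) : ℂ)‖ ≤ 𝔓 := by
      rw [Complex.norm_intCast]
      exact abs_pcoef_le (hσrS i) (hτT j) hS₁1 hT₁1 (hsrS i) (htcT j)
    have h2 : ‖ξ ^ (tc j * sr i) - e ^ (tc j * sr i)‖ ≤ N * 4 ^ N * δ :=
      norm_zpow_sub_zpow_le hξ1 hξ4 (htsN i j)
    have h3 : (N : ℝ) * 4 ^ N ≤ Real.exp (T₁ * (E * S₁)) := by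
      refine (nat_mul_four_pow_le_exp N).trans ?_
      rw [Real.exp_le_exp, hN]; push_cast
      have h0 : (0 : ℝ) ≤ (T₁ : ℝ) * S₁ := by positivity
      calc (2.7 : ℝ) * (T₁ * S₁) ≤ E * (T₁ * S₁) := mul_le_mul_of_nonneg_right hE27 h0
        _ = T₁ * (E * S₁) := by ring
    have h4 : 𝔓 * Real.exp (T₁ * (E * S₁)) ≤ 𝔐 := by
      rw [h𝔐, h𝔓, mul_pow]
      have hET : (1 : ℝ) ≤ E ^ T := one_le_pow₀ hE1
      have h0 : (0 : ℝ) ≤ (S₁ : ℝ) ^ T * ((T : ℝ) + T₁) ^ S * Real.exp (T₁ * (E * S₁)) := by positivity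
      calc (S₁ : ℝ) ^ T * ((T : ℝ) + T₁) ^ S * Real.exp (T₁ * (E * S₁))
          = 1 * ((S₁ : ℝ) ^ T * ((T : ℝ) + T₁) ^ S * Real.exp (T₁ * (E * S₁))) := by ring
        _ ≤ E ^ T * ((S₁ : ℝ) ^ T * ((T : ℝ) + T₁) ^ S * Real.exp (T₁ * (E * S₁))) :=
            mul_le_mul_of_nonneg_right hET h0
        _ = E ^ T * (S₁ : ℝ) ^ T * ((T : ℝ) + T₁) ^ S * Real.exp (T₁ * (E * S₁)) := by ring
    calc ‖(pcoef (σr i) j.1 (sr i) (tc j) : ℂ)‖ * ‖ξ ^ (tc j * sr i) - e ^ (tc j * sr i)‖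
        ≤ 𝔓 * (N * 4 ^ N * δ) := mul_le_mul h1 h2 (norm_nonneg _) h𝔓pos.le
      _ ≤ 𝔓 * (Real.exp (T₁ * (E * S₁)) * ε) := by
          refine mul_le_mul_of_nonneg_left ?_ h𝔓pos.le
          exact mul_le_mul h3 hδε (by positivity) (by positivity)
      _ = ε * (𝔓 * Real.exp (T₁ * (E * S₁))) := by ring
      _ ≤ ε * 𝔐 := mul_le_mul_of_nonneg_left h4 hεpos.le
  have hεE : ε * E ^ Fintype.card (Fin (T + 1) × Fin (2 * T₁ + 1)) ≤ 1 := by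
    rw [hcard, hε, inv_mul_cancel₀ (by positivity)]
  have hAsq_eq : Asq = Matrix.of fun i j => iteratedDeriv (σr i) (f j) (ζ i) + P i j := by
    ext i j; simp [hP]
  have hup := norm_det_interpolation_deriv_le f hf_diff σr ζ P hE1 hζS₁ h𝔐pos.le hεpos.le hεE hfM hPM
  rw [← hAsq_eq, hcard] at hup
  -- simplify: `L! ≤ L^L`, `E^{Σσ} ≤ E^{LS}`
  have hsumσ : ∑ i, σr i ≤ L * S := by
    calc ∑ i, σr i ≤ ∑ _i : Fin (T + 1) × Fin (2 * T₁ + 1), S := Finset.sum_le_sum fun i _ => hσrS i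
      _ = L * S := by rw [Finset.sum_const, Finset.card_univ, hcard, smul_eq_mul]
  have hUB : ‖Asq.det‖ * E ^ (∑ x ∈ range L, x) ≤ 2 ^ L * (L : ℝ) ^ L * 𝔐 ^ L * E ^ (L * S) := by
    have h1 : ‖Asq.det‖ ≤ 2 ^ L * (L.factorial : ℝ) * 𝔐 ^ L * E ^ (∑ i, σr i) / E ^ (∑ x ∈ range L, x) := hup
    rw [le_div_iff₀ (by positivity)] at h1
    refine h1.trans ?_
    have h2 : (L.factorial : ℝ) ≤ (L : ℝ) ^ L := by exact_mod_cast Nat.factorial_le_pow L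
    have h3 : E ^ (∑ i, σr i) ≤ E ^ (L * S) := pow_le_pow_right₀ hE1 hsumσ
    gcongr
  /- c) the arithmetic lower bound -/
  set pZ : Fin (T + 1) × Fin (2 * T₁ + 1) → Fin (T + 1) × Fin (2 * T₁ + 1) → ℤ :=
    fun i j => pcoef (σr i) j.1 (sr i) (tc j) with hpZ
  set ex : Fin (T + 1) × Fin (2 * T₁ + 1) → Fin (T + 1) × Fin (2 * T₁ + 1) → ℕ :=
    fun i j => Int.toNat (tc j * sr i + |tc j| * S₁) with hex
  set G : ℤ[X] := (Matrix.of fun i j => C (pZ i j) * Polynomial.X ^ (ex i j)).det with hG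
  have hex_nonneg : ∀ i j, 0 ≤ tc j * sr i + |tc j| * S₁ := fun i j => shift_nonneg (hsrS i)
  have hex_cast : ∀ i j, ((ex i j : ℕ) : ℤ) = tc j * sr i + |tc j| * S₁ := fun i j =>
    Int.toNat_of_nonneg (hex_nonneg i j)
  set nsh : Fin (T + 1) × Fin (2 * T₁ + 1) → ℕ := fun j => (tc j).natAbs * S₁ with hnsh
  have hm_eq : ∑ j, nsh j = m := by
    simp only [hnsh, htc]
    rw [← Finset.sum_mul, Fintype.sum_prod_type]
    simp only [Finset.sum_const, Finset.card_univ, Fintype.card_fin, smul_eq_mul]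
    rw [sum_natAbs_sub_eq T₁, hm]; ring
  have hpow_ex : ∀ i j, ξ ^ (ex i j) = ξ ^ (nsh j) * ξ ^ (tc j * sr i) := by
    intro i j
    rw [← zpow_natCast, hex_cast, zpow_add₀ hξ0, mul_comm, ← zpow_natCast]
    congr 1
    simp only [hnsh, Nat.cast_mul, Int.natCast_natAbs]
  have haevalG : aeval ξ G = ξ ^ m * Asq.det := by
    rw [hG, aeval_det_monomialMatrix]
    have : (Matrix.of fun i j => (pZ i j : ℂ) * ξ ^ (ex i j)) =
        Matrix.of fun i j => ξ ^ (nsh j) * Asq i j := by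
      ext i j; simp only [Matrix.of_apply, hAsq_apply, hpow_ex, hpZ]; ring
    rw [this, Matrix.det_mul_row, Finset.prod_pow_eq_pow_sum, hm_eq]
  have hGne : aeval ξ G ≠ 0 := by
    rw [haevalG]; exact mul_ne_zero (pow_ne_zero _ hξ0) hdet
  -- degree of `G`
  have hex_le : ∀ i j, ex i j ≤ 2 * nsh j := by
    intro i j
    have h1 : ((ex i j : ℕ) : ℤ) ≤ 2 * (|tc j| * S₁) := by rw [hex_cast]; exact shift_le (hsrS i)
    have h2 : ((nsh j : ℕ) : ℤ) = |tc j| * S₁ := by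
      simp only [hnsh, Nat.cast_mul, Int.natCast_natAbs]
    rw [← h2] at h1
    exact_mod_cast h1
  have hdegG : G.natDegree ≤ 2 * m := by
    rw [hG, det_monomialMatrix]
    refine natDegree_sum_monomial_le _ _ _ fun π _ => ?_
    calc ∑ j, ex (π j) j ≤ ∑ j, 2 * nsh j := Finset.sum_le_sum fun j _ => hex_le (π j) j
      _ = 2 * m := by rw [← Finset.mul_sum, hm_eq]
  -- length of `G`
  have h𝔓L : ∀ i j, |(pZ i j : ℝ)| ≤ 𝔓 := fun i j =>
    abs_pcoef_le (hσrS i) (hτT j) hS₁1 hT₁1 (hsrS i) (htcT j)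
  have hlenG : ∑ k ∈ range (G.natDegree + 1), |(G.coeff k : ℝ)| ≤ (L : ℝ) ^ L * 𝔓 ^ L := by
    rw [hG, det_monomialMatrix]
    refine (length_sum_monomial_le _ _ _).trans ?_
    calc ∑ π : Equiv.Perm (Fin (T + 1) × Fin (2 * T₁ + 1)),
          |((((Equiv.Perm.sign π : ℤˣ) : ℤ) * ∏ j, pZ (π j) j : ℤ) : ℝ)|
        ≤ ∑ _π : Equiv.Perm (Fin (T + 1) × Fin (2 * T₁ + 1)), 𝔓 ^ L := by
          refine Finset.sum_le_sum fun π _ => ?_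
          rw [Int.cast_mul, abs_mul, Int.cast_prod, Finset.abs_prod]
          have hsign : |(((Equiv.Perm.sign π : ℤˣ) : ℤ) : ℝ)| = 1 := by
            rcases Int.units_eq_one_or (Equiv.Perm.sign π) with h | h <;> simp [h]
          rw [hsign, one_mul, ← hcard, ← Finset.card_univ, ← Finset.prod_const]
          exact Finset.prod_le_prod (fun _ _ => abs_nonneg _) fun j _ => h𝔓L (π j) j
      _ = (L.factorial : ℝ) * 𝔓 ^ L := by
          rw [Finset.sum_const, Finset.card_univ, Fintype.card_perm, hcard, nsmul_eq_mul]
      _ ≤ (L : ℝ) ^ L * 𝔓 ^ L := by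
          gcongr; exact_mod_cast Nat.factorial_le_pow L
  -- Liouville
  set M : ℝ := (Q.map (Int.castRingHom ℂ)).mahlerMeasure with hMdef
  have hQ0 : Q ≠ 0 := by intro h; apply hQ.ne_zero; rw [h, Polynomial.map_zero]
  have hM1 : 1 ≤ M := one_le_mahlerMeasure_map hQ0
  have hMℓ : M ≤ Real.exp ℓ := by
    calc M = Real.exp (Real.log M) := (Real.exp_log (lt_of_lt_of_le zero_lt_one hM1)).symm
      _ ≤ Real.exp ℓ := Real.exp_le_exp.mpr hMℓ
  have hLiou := liouville hQ hξQ hGne hlenG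
  set Λ : ℝ := (L : ℝ) ^ L * 𝔓 ^ L with hΛ
  have hΛpos : 0 < Λ := by rw [hΛ]; positivity
  have hLB : 1 ≤ Λ ^ (D - 1) * M ^ (2 * m) * 4 ^ m * ‖Asq.det‖ := by
    have h1 : (1 : ℝ) ≤ max 1 ‖ξ‖ ^ G.natDegree := one_le_pow₀ (le_max_left _ _)
    have h2 : M ^ G.natDegree ≤ M ^ (2 * m) := pow_le_pow_right₀ hM1 hdegG
    have h3 : ‖aeval ξ G‖ ≤ 4 ^ m * ‖Asq.det‖ := by
      rw [haevalG, norm_mul, norm_pow]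
      exact mul_le_mul_of_nonneg_right (pow_le_pow_left₀ (norm_nonneg _) hξ4 m) (norm_nonneg _)
    calc (1 : ℝ) ≤ max 1 ‖ξ‖ ^ G.natDegree := h1
      _ ≤ Λ ^ (D - 1) * M ^ G.natDegree * ‖aeval ξ G‖ := hLiou
      _ ≤ Λ ^ (D - 1) * M ^ (2 * m) * (4 ^ m * ‖Asq.det‖) := by gcongr
      _ = Λ ^ (D - 1) * M ^ (2 * m) * 4 ^ m * ‖Asq.det‖ := by ring
  /- d) the contradiction -/
  -- combine b) and c): `E^{Σ} ≤ Λ^{D-1} M^{2m} 4^m 2^L L^L 𝔐^L E^{LS}`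
  have hcomb : E ^ (∑ x ∈ range L, x) ≤
      Λ ^ (D - 1) * M ^ (2 * m) * 4 ^ m * (2 ^ L * (L : ℝ) ^ L * 𝔐 ^ L * E ^ (L * S)) := by
    have h1 := mul_le_mul_of_nonneg_left hUB
      (by positivity : (0 : ℝ) ≤ Λ ^ (D - 1) * M ^ (2 * m) * 4 ^ m)
    have h2 := mul_le_mul_of_nonneg_right hLB (by positivity : (0 : ℝ) ≤ E ^ (∑ x ∈ range L, x))
    rw [one_mul] at h2
    calc E ^ (∑ x ∈ range L, x)
        ≤ Λ ^ (D - 1) * M ^ (2 * m) * 4 ^ m * ‖Asq.det‖ * E ^ (∑ x ∈ range L, x) := h2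
      _ = Λ ^ (D - 1) * M ^ (2 * m) * 4 ^ m * (‖Asq.det‖ * E ^ (∑ x ∈ range L, x)) := by ring
      _ ≤ Λ ^ (D - 1) * M ^ (2 * m) * 4 ^ m * (2 ^ L * (L : ℝ) ^ L * 𝔐 ^ L * E ^ (L * S)) := h1
  -- everything as exponentials
  have hlog𝔓 : Real.log 𝔓 = T * Real.log S₁ + S * Real.log ((T : ℝ) + T₁) := by
    rw [h𝔓, Real.log_mul (by positivity) (by positivity), Real.log_pow, Real.log_pow]
  have h𝔓exp : 𝔓 = Real.exp (T * Real.log S₁ + S * Real.log ((T : ℝ) + T₁)) := by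
    rw [← hlog𝔓, Real.exp_log h𝔓pos]
  have h𝔐exp : 𝔐 = Real.exp (T * lgE + (T * Real.log S₁ + S * Real.log ((T : ℝ) + T₁)) +
      T₁ * (E * S₁)) := by
    rw [Real.exp_add, Real.exp_add, ← h𝔓exp, Real.exp_nat_mul lgE T, hexpE, h𝔐, h𝔓, mul_pow]; ring
  have hΛexp : Λ = Real.exp (L * Real.log L + L * (T * Real.log S₁ + S * Real.log ((T : ℝ) + T₁))) := by
    rw [hΛ, Real.exp_add, Real.exp_nat_mul, Real.exp_nat_mul, Real.exp_log hLpos, ← h𝔓exp]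
  have hRHS : Λ ^ (D - 1) * M ^ (2 * m) * 4 ^ m * (2 ^ L * (L : ℝ) ^ L * 𝔐 ^ L * E ^ (L * S)) ≤
      Real.exp ((L : ℝ) * Real.log 2 + D * L * Real.log L +
        D * L * (T * Real.log S₁ + S * Real.log ((T : ℝ) + T₁)) +
        ((T : ℝ) + S) * L * lgE + L * (E * T₁ * S₁) + 2 * m * ℓ + m * Real.log 4) := by
    have hM2m : M ^ (2 * m) ≤ Real.exp (2 * m * ℓ) := by
      calc M ^ (2 * m) ≤ (Real.exp ℓ) ^ (2 * m) := pow_le_pow_left₀ (by linarith only [hM1]) hMℓ _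
        _ = Real.exp (2 * m * ℓ) := by rw [← Real.exp_nat_mul]; push_cast; ring_nf
    have h4m : (4 : ℝ) ^ m = Real.exp (m * Real.log 4) := by
      rw [Real.exp_nat_mul, Real.exp_log (by norm_num)]
    have h2L : (2 : ℝ) ^ L = Real.exp (L * Real.log 2) := by
      rw [Real.exp_nat_mul, Real.exp_log (by norm_num)]
    have hLL : (L : ℝ) ^ L = Real.exp (L * Real.log L) := by
      rw [Real.exp_nat_mul, Real.exp_log hLpos]
    have hELS : E ^ (L * S) = Real.exp ((L * S : ℕ) * lgE) := by rw [Real.exp_nat_mul, hexpE]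
    have hΛD : Λ ^ (D - 1) = Real.exp ((D - 1 : ℕ) *
        (L * Real.log L + L * (T * Real.log S₁ + S * Real.log ((T : ℝ) + T₁)))) := by
      rw [hΛexp, ← Real.exp_nat_mul]
    have h𝔐L : 𝔐 ^ L = Real.exp (L * (T * lgE + (T * Real.log S₁ + S * Real.log ((T : ℝ) + T₁)) +
        T₁ * (E * S₁))) := by rw [h𝔐exp, ← Real.exp_nat_mul]
    have hD1r : ((D - 1 : ℕ) : ℝ) = (D : ℝ) - 1 := by rw [Nat.cast_sub hD1]; simp
    rw [hΛD, h4m, h2L, hLL, hELS, h𝔐L]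
    calc Real.exp (((D - 1 : ℕ) : ℝ) * ((L : ℝ) * Real.log L +
            L * (T * Real.log S₁ + S * Real.log ((T : ℝ) + T₁)))) * M ^ (2 * m) *
            Real.exp (m * Real.log 4) *
          (Real.exp (L * Real.log 2) * Real.exp (L * Real.log L) *
            Real.exp (L * (T * lgE + (T * Real.log S₁ + S * Real.log ((T : ℝ) + T₁)) + T₁ * (E * S₁))) *
            Real.exp (((L * S : ℕ) : ℝ) * lgE))
        ≤ Real.exp (((D - 1 : ℕ) : ℝ) * ((L : ℝ) * Real.log L +
            L * (T * Real.log S₁ + S * Real.log ((T : ℝ) + T₁)))) * Real.exp (2 * m * ℓ) *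
            Real.exp (m * Real.log 4) *
          (Real.exp (L * Real.log 2) * Real.exp (L * Real.log L) *
            Real.exp (L * (T * lgE + (T * Real.log S₁ + S * Real.log ((T : ℝ) + T₁)) + T₁ * (E * S₁))) *
            Real.exp (((L * S : ℕ) : ℝ) * lgE)) := by gcongr
      _ = Real.exp ((L : ℝ) * Real.log 2 + D * L * Real.log L +
            D * L * (T * Real.log S₁ + S * Real.log ((T : ℝ) + T₁)) +
            ((T : ℝ) + S) * L * lgE + L * (E * T₁ * S₁) + 2 * m * ℓ + m * Real.log 4) := by
          simp only [← Real.exp_add]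
          congr 1
          rw [hD1r]; push_cast; ring
  -- the exponent of `E`: `∑_{x<L} x = L(L-1)/2`
  have hsumL : ((∑ x ∈ range L, x : ℕ) : ℝ) = (L : ℝ) * (L - 1) / 2 := by
    have h := Finset.sum_range_id_mul_two L
    have h' : ((∑ x ∈ range L, x : ℕ) : ℝ) * 2 = (L : ℝ) * ((L - 1 : ℕ) : ℝ) := by exact_mod_cast h
    rw [Nat.cast_sub hL1, Nat.cast_one] at h'
    linarith only [h']
  have hLHS : E ^ (∑ x ∈ range L, x) = Real.exp ((L : ℝ) * (L - 1) / 2 * lgE) := by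
    rw [← hexpE, ← Real.exp_nat_mul, hsumL]
  have := lt_of_le_of_lt (hcomb.trans hRHS) (Real.exp_lt_exp.mpr hmain)
  rw [hLHS] at this
  exact lt_irrefl _ this

/-! ### Theorem 4 (2): the transcendence measure -/

/-- **Nesterenko–Waldschmidt 1996, Theorem 4 (2)** (unfolded): if `P ∈ ℤ[x]`, `P ≠ 0`,
`deg P ≤ d` (`d ≥ 1`), `L(P) ≤ L` and `L ≥ 3`, then `|P(e)| ≥ exp(-1.3·10⁵ · d² · (log L + d))`.
Proof: part II (transference, with `ℓ = log L ≥ log M(P)`) applied to `approx_measure_exp_one`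
gives the constant `63021 + 3`. [cite: NesterenkoWaldschmidt1996, Theorem 4 (2)] -/
theorem transcendence_measure_exp_one (P : ℤ[X]) (d L : ℕ) (hP : P ≠ 0) (hd : 1 ≤ d)
    (hdeg : P.natDegree ≤ d) (hlen : (∑ k ∈ range (P.natDegree + 1), |P.coeff k|) ≤ (L : ℤ))
    (hL : 3 ≤ L) :
    Real.exp (-(1.3 * 10 ^ 5 * (d : ℝ) ^ 2 * (Real.log L + d))) ≤ ‖aeval (cexp 1) P‖ := by
  set ℓ : ℝ := Real.log L with hℓ
  have hL3 : (3 : ℝ) ≤ L := by exact_mod_cast hL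
  have hℓ1 : 1 ≤ ℓ := by
    rw [hℓ, ← Real.log_exp 1]
    refine Real.log_le_log (Real.exp_pos 1) (le_trans ?_ hL3)
    have := Real.exp_one_lt_d9; linarith
  -- `log M(P) ≤ log L(P) ≤ log L`
  have hlenR : (∑ k ∈ range (P.natDegree + 1), |(P.coeff k : ℝ)|) ≤ L := by
    have h : ((∑ k ∈ range (P.natDegree + 1), |P.coeff k| : ℤ) : ℝ) ≤ ((L : ℤ) : ℝ) := by
      exact_mod_cast hlen
    push_cast at h
    simpa [Int.cast_abs] using h
  have hM : Real.log (P.map (Int.castRingHom ℂ)).mahlerMeasure ≤ ℓ := by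
    rw [hℓ]
    refine Real.log_le_log (lt_of_lt_of_le zero_lt_one (one_le_mahlerMeasure_map hP)) ?_
    exact (mahlerMeasure_map_le_length P).trans hlenR
  have happrox : ∀ Q : ℤ[X], Irreducible (Q.map (Int.castRingHom ℚ)) →
      Real.log (Q.map (Int.castRingHom ℂ)).mahlerMeasure ≤ ℓ → ∀ ξ : ℂ, aeval ξ Q = 0 →
      Real.exp (-(63021 * (Q.natDegree : ℝ) ^ 2 * (Q.natDegree + ℓ))) ≤ ‖cexp 1 - ξ‖ :=
    fun Q hQ hMQ ξ hξ => approx_measure_exp_one hQ hξ hℓ1 hMQ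
  have h := transference (cexp 1) (by norm_num : (0 : ℝ) ≤ 63021) hℓ1 happrox hP hM
  refine le_trans ?_ h
  rw [Real.exp_le_exp, neg_le_neg_iff]
  have hn : (P.natDegree : ℝ) ≤ d := by exact_mod_cast hdeg
  have hn0 : (0 : ℝ) ≤ P.natDegree := Nat.cast_nonneg _
  have hℓ0 : 0 ≤ ℓ := by linarith
  calc (63021 + 3) * (P.natDegree : ℝ) ^ 2 * (P.natDegree + ℓ)
      ≤ (63021 + 3) * (d : ℝ) ^ 2 * (d + ℓ) := by gcongr
    _ ≤ 1.3 * 10 ^ 5 * (d : ℝ) ^ 2 * (Real.log L + d) := by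
        rw [hℓ]
        have : (0 : ℝ) ≤ (d : ℝ) ^ 2 * (d + Real.log L) := by positivity
        nlinarith

end NW1996

/-! ### Discharge of the named fact -/

/-- **Nesterenko–Waldschmidt 1996, Theorem 4 (2)** holds: the named fact
`NesterenkoWaldschmidt1996_thm_4_2` of `ExpOneTranscendenceMeasure.lean` ("if `P ∈ ℤ[x]`, `P ≠ 0`,
`deg P ≤ d`, `L(P) ≤ L`, `L ≥ 3`, then `|P(e)| ≥ exp(-1.3·10⁵ d² (log L + d))`"), by
`NW1996.transcendence_measure_exp_one`. [cite: NesterenkoWaldschmidt1996, Theorem 4 (2)] -/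
theorem NesterenkoWaldschmidt1996_thm_4_2_holds : NesterenkoWaldschmidt1996_thm_4_2 := by
  intro P d L hP hd hdeg hlen hL
  have h := NW1996.transcendence_measure_exp_one P d L hP hd hdeg hlen hL
  simpa only [Complex.ofReal_exp, Complex.ofReal_one] using h

end Literature.NumberTheory.Transcendental

end
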